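import Literature.AlgebraicGeometry.HodgeTheory.GAGAFreeSheavesProjectiveSpace
import Literature.Algebra.Homology.OrderedCechKoszulKernels
import HarnessLib

/-!
# GAGA for the sheaves of twisted differential forms `Ω^p_{ℙ_r}(n)` on `ℙ_r(ℂ)` (Serre 1956,
# Théorème 1, by the dévissage of n° 13 applied to the exterior powers of the Euler sequence)

Serre, *GAGA*, n° 12, Théorème 1: "Pour tout faisceau algébrique cohérent `𝓕` sur `X`, et pour tout
entier `q ≥ 0`, l'homomorphisme `ε : H^q(X, 𝓕) → H^q(X^h, 𝓕^h)` est bijectif." The proof (n° 13)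
reduces to `X = ℙ_r(ℂ)`, proves the case `𝓕 = 𝒪(n)` (Lemme 5) and passes to every coherent `𝓕`
through exact sequences of sheaves, the two long exact cohomology sequences and the five lemma.
This file carries out that dévissage for the sheaves `Ω^p_{ℙ_r}(n)` (all `r, p ≥ 0`, `n ∈ ℤ`),
starting from the tree's Lemme 5 for free sheaves (`GAGAFree.quasiIso_cechComparison`) and using
the exact sequences of vector bundles (Okonek–Schneider–Spindler, Ch. I §1.1 (3), "if one dualizes
the Euler sequence and takes the `p`th exterior power")

  `0 → Ω^p_{ℙ_r}(p) → 𝒪^{(r+1 choose p)} → Ω^{p-1}_{ℙ_r}(p) → 0`,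

i.e. the Koszul complex of the coordinates `x₀, …, x_r` on `Λ^p 𝒪(-1)^{r+1} = 𝒪(-p)^{(r+1 choose p)}`,
whose cycle sheaves are the `Ω^p` and which is split over every standard affine `U_s`, `s ≠ ∅`, by
the cone `x_{i₀}⁻¹ e_{i₀} ∧ ·` (Görtz–Wedhorn II, Rem. 22.87). The homological algebra (the short
exact sequences of ordered Čech complexes and the two-out-of-three passage of quasi-isomorphisms
to the kernels, by descending induction on `p`) is the engine
`Literature/Algebra/Homology/OrderedCechKoszulKernels.lean`; here we supply Serre's two section
functors and the evaluation map between them: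

* `𝕂 = Γ(T, 𝒪)` (`GAGATwist.holTorus r`) is a module over the Laurent polynomial ring
  `L = ℂ[x₀^{±1}, …, x_r^{±1}]` (`instModuleLHolTorus`; `(v • f)(x) = v(x) f(x)`), and evaluation
  `holEvalL : L →ₗ[L] 𝕂` is `L`-linear;
* the ALGEBRAIC datum `algDatum r n`: `Γ(U_s, Λ^q(n)) = ((L^{Sub q})_{x_s})_n` — the tree's
  `LaurentCech.locDeg (fun _ => q) ⊤ s n`, Serre FAC n° 64 — and
  `Γ(U_s, Ω^q(n)) = LaurentCech.locDeg (fun _ => q) (Zsub r q) s n` for the graded kernel module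
  **`Zsub r q = ker (∂ : P(-q)^{(r+1 choose q)} → P(-q+1)^{(r+1 choose q-1)})`, whose associated sheaf
  is `Ω^q_{ℙ_r}`** [OSS (3)]; stability under `x_i ·` and, on `U_s ∋ i`, under `x_i⁻¹ ·`
  (`X_mul_mem_algPiece`, `Xinv_mul_mem_algPiece`);
* the HOLOMORPHIC datum `holDatum r n`: `Γ(U_s^h, Λ^q(n)^h)` = `GAGAFree.holFamily r (fun _ => q) n s`
  (tuples of holomorphic functions on the cone `Û_s` homogeneous of degree `n - q`, Serre n° 16) and
  **`holFormsFamily r q n s = Γ(U_s^h, Ω^q(n)^h)`** = those tuples killed by the Koszul contraction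
  (sections of a kernel sheaf are the kernel on sections);
* `algHolHom r n`, the evaluation `ψ = holEvalL`, a morphism of data; its free comparison maps ARE
  the tree's `GAGAFree.cechComparison r (fun _ => q) n` (`freeMap_eq`), quasi-isomorphisms by
  `GAGAFree.quasiIso_cechComparison` (Lemme 5);
* **`GAGAForms.quasiIso_cechComparison r p n`** — GAGA Théorème 1 for `Ω^p_{ℙ_r}(n)`: the evaluation
  map from the algebraic Čech complex `LaurentCech.cech (fun _ => p) (Zsub r p) n` of `Ω^p(n)` on the
  standard cover to the holomorphic ordered Čech complex `holCech r p n` of `Ω^p(n)^h` is a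
  quasi-isomorphism; `isIso_homologyMap_cechComparison` (all Čech degrees).

Honesty / what is NOT here. This is the `Ω^p_{ℙ_r}`-instance of the projective Čech-GAGA node (P3) of
the lane's Route P, in the `LaurentCech` / cone-section language of the `𝒪(n)` files; it does not
discharge the row hypothesis `hrows` of `AlgebraicCechHolomorphicDeRham` (arbitrary smooth projective
`X`, `CoverCharts.realizeHolHom` format) — the junction with `CoverCharts` for `X = ℙ_r` and the
dévissage for arbitrary coherent sheaves are not in this file. Everything is proved; definitions with
bodies; no named facts (net debt 0).

## References
* [SerreGAGA1956] J.-P. Serre, *Géométrie algébrique et géométrie analytique*, Ann. Inst. Fourier 6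
  (1956): n° 12 Théorème 1; n° 13 (Lemme 5 and the dévissage); n° 16 (sections of `𝒪(n)` on `U_s`).
* [OkonekSchneiderSpindler1980] C. Okonek, M. Schneider, H. Spindler, *Vector Bundles on Complex
  Projective Spaces* (1980), Ch. I §1.1, (2) Euler sequence, (3)
  `0 → Ω^p(p) → 𝒪^{(n+1 choose p)} → Ω^{p-1}(p) → 0`.
* [GortzWedhorn2023] U. Görtz, T. Wedhorn, *Algebraic Geometry II*, Rem. 22.87 (the Koszul complex
  of `π^*𝓔(-1) → 𝒪` on `ℙ(𝓔)`, contractible where `u` has a section).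
* [SerreFAC1955] J.-P. Serre, *Faisceaux algébriques cohérents*, n° 64 (sections of `𝒪(n)` over
  `U_{i₀…i_p}`).
-/

noncomputable section

open Set Function CategoryTheory Finset

namespace Literature.AlgebraicGeometry.HodgeTheory

namespace GAGAForms

open Literature.Analysis.Complex.LaurentSeparation Literature.Algebra.Homology
  Literature.Algebra.Homology.LaurentCech Literature.Algebra.Homology.OrderedCech
  Literature.Algebra.Homology.KoszulCech GAGATwist

variable {r : ℕ}

/-! ### `𝕂 = Γ(T, 𝒪)` as a module over the Laurent polynomials -/

/-- `x^0 = 1` everywhere. [cite: SerreFAC1955, n° 64] -/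
theorem monoEval_zero (x : Fin (r + 1) → ℂ) : monoEval (0 : Expt r) x = 1 := by
  simp [monoEval]

/-- `lauEval 1 = 1`. [cite: SerreFAC1955, n° 64] -/
theorem lauEval_one (x : Fin (r + 1) → ℂ) : lauEval (1 : L ℂ r) x = 1 := by
  rw [AddMonoidAlgebra.one_def, lauEval_single, monoEval_zero, mul_one]

/-- **Multiplicativity of evaluation on the torus**: `(v w)(x) = v(x) w(x)` for `x ∈ T`.
[cite: SerreFAC1955, n° 64] -/
theorem lauEval_mul {x : Fin (r + 1) → ℂ} (hx : x ∈ torus r) (v w : L ℂ r) :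
    lauEval (v * w) x = lauEval v x * lauEval w x := by
  induction v using AddMonoidAlgebra.induction_linear with
  | zero => simp
  | add v v' hv hv' => rw [add_mul, map_add, map_add, Pi.add_apply, Pi.add_apply, hv, hv', add_mul]
  | single m a =>
    have : AddMonoidAlgebra.single m a = a • AddMonoidAlgebra.single m (1 : ℂ) := by
      rw [AddMonoidAlgebra.smul_single, smul_eq_mul, mul_one]
    rw [this, smul_mul_assoc, map_smul, map_smul, Pi.smul_apply, Pi.smul_apply, smul_eq_mul,
      smul_eq_mul, lauEval_single_mul hx, lauEval_single, one_mul, mul_assoc]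

/-- The action of a Laurent polynomial on `𝕂 = Γ(T, 𝒪)`: `(v • f)(x) = v(x) f(x)` (a holomorphic
function on `T` times a member of `𝕂`, still vanishing off `T`). [cite: SerreGAGA1956, n° 13 Lemme 5] -/
def lsmul (v : L ℂ r) (f : holTorus r) : holTorus r :=
  ⟨fun x => lauEval v x * (f : (Fin (r + 1) → ℂ) → ℂ) x,
    ⟨(differentiableOn_lauEval_torus v).mul f.2.1, fun x hx => by simp only [f.2.2 x hx, mul_zero]⟩⟩

/-- The value of `v • f`. [cite: SerreGAGA1956, n° 13 Lemme 5] -/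
@[simp] theorem coe_lsmul_apply (v : L ℂ r) (f : holTorus r) (x : Fin (r + 1) → ℂ) :
    (lsmul v f : (Fin (r + 1) → ℂ) → ℂ) x = lauEval v x * (f : (Fin (r + 1) → ℂ) → ℂ) x := rfl

/-- **`𝕂 = Γ(T, 𝒪)` is a module over `L = ℂ[x₀^{±1}, …, x_r^{±1}]`** (the regular functions on the
torus act on the holomorphic ones by multiplication). [cite: SerreGAGA1956, n° 13 Lemme 5] -/
instance instModuleLHolTorus : Module (L ℂ r) (holTorus r) where
  smul := lsmul
  one_smul f := by
    apply Subtype.ext; funext x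
    change lauEval (1 : L ℂ r) x * _ = _
    rw [lauEval_one, one_mul]
  mul_smul v w f := by
    apply Subtype.ext; funext x
    change lauEval (v * w) x * _ = lauEval v x * (lauEval w x * _)
    by_cases hx : x ∈ torus r
    · rw [lauEval_mul hx, mul_assoc]
    · rw [f.2.2 x hx, mul_zero, mul_zero, mul_zero]
  smul_zero v := by
    apply Subtype.ext; funext x
    change lauEval v x * 0 = 0
    rw [mul_zero]
  smul_add v f g := by
    apply Subtype.ext; funext x
    change lauEval v x * ((f : (Fin (r + 1) → ℂ) → ℂ) x + (g : (Fin (r + 1) → ℂ) → ℂ) x) =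
      lauEval v x * (f : (Fin (r + 1) → ℂ) → ℂ) x + lauEval v x * (g : (Fin (r + 1) → ℂ) → ℂ) x
    rw [mul_add]
  add_smul v w f := by
    apply Subtype.ext; funext x
    change lauEval (v + w) x * _ = lauEval v x * _ + lauEval w x * _
    rw [map_add, Pi.add_apply, add_mul]
  zero_smul f := by
    apply Subtype.ext; funext x
    change lauEval (0 : L ℂ r) x * _ = 0
    rw [map_zero, Pi.zero_apply, zero_mul]

/-- The value of `v • f`. [cite: SerreGAGA1956, n° 13 Lemme 5] -/
theorem coe_smul_apply (v : L ℂ r) (f : holTorus r) (x : Fin (r + 1) → ℂ) :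
    ((v • f : holTorus r) : (Fin (r + 1) → ℂ) → ℂ) x = lauEval v x * (f : (Fin (r + 1) → ℂ) → ℂ) x :=
  rfl

/-- The `L`-action extends the `ℂ`-action. [cite: SerreGAGA1956, n° 13 Lemme 5] -/
instance instIsScalarTowerLHolTorus : IsScalarTower ℂ (L ℂ r) (holTorus r) :=
  ⟨fun c v f => by
    apply Subtype.ext; funext x
    rw [coe_smul_apply, Submodule.coe_smul, Pi.smul_apply, coe_smul_apply, map_smul, Pi.smul_apply,
      smul_eq_mul, smul_eq_mul, mul_assoc]⟩

variable (r) in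
/-- **Evaluation `ψ : L → 𝕂` is `L`-linear** (`(v w)|_T = v|_T · w|_T`). [cite: SerreGAGA1956, n° 13 Lemme 5] -/
def holEvalL : L ℂ r →ₗ[L ℂ r] holTorus r where
  toFun := holEval r
  map_add' := (holEval r).map_add
  map_smul' v w := by
    apply Subtype.ext; funext x
    rw [RingHom.id_apply, coe_smul_apply, smul_eq_mul]
    by_cases hx : x ∈ torus r
    · rw [coe_holEval_apply hx, coe_holEval_apply hx, lauEval_mul hx]
    · rw [(holEval r w).2.2 x hx, (holEval r (v * w)).2.2 x hx, mul_zero]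

/-- `holEvalL` is `holEval`. [cite: SerreGAGA1956, n° 13 Lemme 5] -/
@[simp] theorem holEvalL_apply (w : L ℂ r) : holEvalL r w = holEval r w := rfl

/-! ### The Koszul structure: coordinates and their inverses in `L` -/

variable (r) in
/-- The coordinate `x_i` as a Laurent monomial. [cite: SerreFAC1955, n° 64] -/
def xL (i : Fin (r + 1)) : L ℂ r := AddMonoidAlgebra.single (Pi.single i 1) 1

variable (r) in
/-- The inverse coordinate `x_i⁻¹` as a Laurent monomial. [cite: SerreFAC1955, n° 64] -/
def uL (i : Fin (r + 1)) : L ℂ r := AddMonoidAlgebra.single (-Pi.single i 1) 1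

/-- `x_i⁻¹ x_i = 1` in `L`. [cite: SerreFAC1955, n° 64] -/
theorem uL_mul_xL (i : Fin (r + 1)) : uL r i * xL r i = 1 := by
  rw [uL, xL, AddMonoidAlgebra.single_mul_single, neg_add_cancel, mul_one, AddMonoidAlgebra.one_def]

/-- `x_i = toL (X_i)`. [cite: SerreFAC1955, n° 64] -/
theorem xL_eq_toL (i : Fin (r + 1)) : xL r i = toL ℂ r (MvPolynomial.X i) := (toL_X i).symm

/-- `x_i ∈ L_1`. [cite: SerreFAC1955, n° 64] -/
theorem xL_mem_Ldeg (i : Fin (r + 1)) : xL r i ∈ Ldeg ℂ r 1 :=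
  single_mem_Ldeg (by rw [edeg_apply]; simp [Pi.single_apply]) 1

/-- `x_i⁻¹ ∈ L_{-1}`. [cite: SerreFAC1955, n° 64] -/
theorem uL_mem_Ldeg (i : Fin (r + 1)) : uL r i ∈ Ldeg ℂ r (-1) :=
  single_mem_Ldeg (by rw [edeg_apply]; simp [Pi.single_apply]) 1

/-- `x_s · x_i⁻¹ = toL (X_{s ∖ i})` for `i ∈ s`. [cite: SerreFAC1955, n° 64] -/
theorem xs_one_mul_uL {s : Finset (Fin (r + 1))} {i : Fin (r + 1)} (hi : i ∈ s) :
    xs ℂ s 1 * uL r i = toL ℂ r (Xs ℂ (s.erase i)) := by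
  rw [← pow_one (Xs ℂ (s.erase i)), toL_Xs_pow, Nat.cast_one, xs, xs, uL,
    AddMonoidAlgebra.single_mul_single, mul_one]
  congr 1
  ext j
  simp only [Pi.add_apply, sx_apply, Pi.neg_apply, Pi.single_apply, Finset.mem_erase]
  by_cases hj : j = i
  · subst hj; simp [hi]
  · simp [hj]

/-- `x_i(x) = x_i` on `ℂ^{r+1}`. [cite: SerreFAC1955, n° 64] -/
theorem lauEval_xL (i : Fin (r + 1)) (x : Fin (r + 1) → ℂ) : lauEval (xL r i) x = x i := by
  rw [xL, lauEval_single, one_mul, monoEval, Finset.prod_eq_single i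
    (fun j _ hj => by rw [Pi.single_eq_of_ne hj, zpow_zero]) (fun h => absurd (Finset.mem_univ i) h),
    Pi.single_eq_same, zpow_one]

/-- `x_i⁻¹(x) = (x_i)⁻¹` on `ℂ^{r+1}`. [cite: SerreFAC1955, n° 64] -/
theorem lauEval_uL (i : Fin (r + 1)) (x : Fin (r + 1) → ℂ) : lauEval (uL r i) x = (x i)⁻¹ := by
  rw [uL, lauEval_single, one_mul, monoEval, Finset.prod_eq_single i
    (fun j _ hj => by rw [Pi.neg_apply, Pi.single_eq_of_ne hj, neg_zero, zpow_zero])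
    (fun h => absurd (Finset.mem_univ i) h), Pi.neg_apply, Pi.single_eq_same, zpow_neg, zpow_one]

/-! ### The algebraic pieces: `((P)_{x_s})_m` and their stability -/

variable (r) in
/-- The constant-tuple map `L → (Unit → L)` (the one-generator free module of the `𝒪(n)` files is
`Unit → L`). [cite: SerreFAC1955, n° 64] -/
def constL : L ℂ r →ₗ[ℂ] (Unit → L ℂ r) where
  toFun w := fun _ => w
  map_add' _ _ := rfl
  map_smul' _ _ := rfl

/-- `constL w = fun _ => w`. [cite: SerreFAC1955, n° 64] -/
@[simp] theorem constL_apply (w : L ℂ r) : constL r w = fun _ => w := rfl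

variable (r) in
/-- The one-variable localized piece `(P_{x_s})_m ⊆ L` (Laurent polynomials of degree `m` with poles
only along `s`), as a submodule of `L`: the tree's `LaurentCech.locDeg (fun _ => 0) ⊤ s m` on
`Unit → L`, pulled back along the constant map. [cite: SerreFAC1955, n° 64] -/
def algPiece (s : Finset (Fin (r + 1))) (m : ℤ) : Submodule ℂ (L ℂ r) :=
  (locDeg (fun _ : Unit => (0 : ℤ)) (Ktop r) s m).comap (constL r)

/-- Membership in `(P_{x_s})_m`, in terms of the tree's localized piece on `Unit → L`.
[cite: SerreFAC1955, n° 64] -/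
theorem mem_algPiece_iff {s : Finset (Fin (r + 1))} {m : ℤ} {w : L ℂ r} :
    w ∈ algPiece r s m ↔ (fun _ : Unit => w) ∈ locDeg (fun _ : Unit => (0 : ℤ)) (Ktop r) s m := by
  rw [algPiece, Submodule.mem_comap, constL_apply]

/-- Membership in `(P_{x_s})_m`: `x_s^N w` is a polynomial for some `N`, and `w ∈ L_m`.
[cite: SerreFAC1955, n° 64] -/
theorem mem_algPiece {s : Finset (Fin (r + 1))} {m : ℤ} {w : L ℂ r} :
    w ∈ algPiece r s m ↔ (∃ (N : ℕ) (p : P ℂ r), xs ℂ s N * w = toL ℂ r p) ∧ w ∈ Ldeg ℂ r m := by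
  rw [mem_algPiece_iff]
  constructor
  · intro hw
    exact exists_of_mem_locDeg (v := fun _ : Unit => w) hw
  · rintro ⟨⟨N, p, hp⟩, hdeg⟩
    exact mem_locDeg_of hp hdeg

/-- **The free pieces are products of one-variable pieces**: `v ∈ ((L^J)_{x_s})_n` iff
`v_j ∈ (P_{x_s})_{n - e_j}` for all `j` (`GAGAFree.mem_locDeg_iff_forall`). [cite: SerreFAC1955, n° 64] -/
theorem mem_locDeg_top_iff {J : Type} [Finite J] (e : J → ℤ) (n : ℤ) (s : Finset (Fin (r + 1)))
    (v : J → L ℂ r) :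
    v ∈ locDeg e (⊤ : Submodule (P ℂ r) (J → P ℂ r)) s n ↔ ∀ j, v j ∈ algPiece r s (n - e j) := by
  simp_rw [mem_algPiece_iff]
  exact GAGAFree.mem_locDeg_iff_forall e n s v

/-- `(P_{x_s})_m` is stable under `x_i ·`, landing in degree `m + 1`. [cite: SerreFAC1955, n° 64] -/
theorem xL_mul_mem_algPiece {s : Finset (Fin (r + 1))} {m : ℤ} {w : L ℂ r} (hw : w ∈ algPiece r s m)
    (i : Fin (r + 1)) : xL r i * w ∈ algPiece r s (m + 1) := by
  obtain ⟨⟨N, p, hp⟩, hdeg⟩ := mem_algPiece.1 hw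
  refine mem_algPiece.2 ⟨⟨N, MvPolynomial.X i * p, ?_⟩, ?_⟩
  · rw [mul_left_comm, hp, xL_eq_toL, map_mul]
  · rw [add_comm]; exact mul_mem_Ldeg (xL_mem_Ldeg i) hdeg

/-- On `U_s ∋ i`, `(P_{x_s})_m` is stable under `x_i⁻¹ ·`, landing in degree `m - 1`.
[cite: SerreFAC1955, n° 64] -/
theorem uL_mul_mem_algPiece {s : Finset (Fin (r + 1))} {m : ℤ} {w : L ℂ r} (hw : w ∈ algPiece r s m)
    {i : Fin (r + 1)} (hi : i ∈ s) : uL r i * w ∈ algPiece r s (m - 1) := by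
  obtain ⟨⟨N, p, hp⟩, hdeg⟩ := mem_algPiece.1 hw
  refine mem_algPiece.2 ⟨⟨N + 1, Xs ℂ (s.erase i) * p, ?_⟩, ?_⟩
  · rw [Nat.cast_add, Nat.cast_one, xs_add, mul_assoc, ← mul_assoc (xs ℂ s 1), xs_one_mul_uL hi,
      mul_left_comm, hp, map_mul]
  · have := mul_mem_Ldeg (uL_mem_Ldeg i) hdeg
    rwa [show (-1 : ℤ) + m = m - 1 by ring] at this

/-! ### The graded kernel module `Z_q` (`= Γ_*(Ω^q)`) and the algebraic datum -/

/-- A sign of `OrderedCech` in `L` acts on any `L`-module as `±1`; submodules over `ℂ` are stable.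
[cite: GortzWedhorn2023, Def. 21.68] -/
theorem sign_mul_smul_mem {M : Type} [AddCommGroup M] [Module (L ℂ r) M] [Module ℂ M]
    [IsScalarTower ℂ (L ℂ r) M] (S : Submodule ℂ M) (s : Finset (Fin (r + 1))) (a : Fin (r + 1))
    {c : L ℂ r} {m : M} (h : c • m ∈ S) : (OrderedCech.sign (L ℂ r) s a * c) • m ∈ S := by
  rw [mul_smul, OrderedCech.sign]
  rcases neg_one_pow_eq_or (L ℂ r) (s.filter (· < a)).card with h1 | h1
  · rw [h1, one_smul]; exact h
  · rw [h1, neg_one_smul]; exact S.neg_mem h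

variable (r) in
/-- **The graded kernel module `Z_q = ker (∂ : Λ^q P^{r+1}(-q) → Λ^{q-1} P^{r+1}(-q+1))`** of the
Koszul differential of `(x₀, …, x_r)` on `P`-tuples indexed by `q`-subsets, as a `P`-submodule of
`P^{Sub q}` (`Z_0 = P`). Its associated sheaf on `ℙ_r = Proj P` is `Ω^q_{ℙ_r}` by the exterior
powers of the Euler sequence, `0 → Ω^q(q) → 𝒪^{(r+1 choose q)} → Ω^{q-1}(q) → 0`.
[cite: OkonekSchneiderSpindler1980, Ch. I §1.1 (3)] -/
def Zsub (q : ℕ) : Submodule (P ℂ r) (Sub (Fin (r + 1)) q → P ℂ r) where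
  carrier := {k | ιK ℂ r (Sub (Fin (r + 1)) q) k ∈ cycles (M := L ℂ r) (xL r) q}
  zero_mem' := by
    simp only [Set.mem_setOf_eq, map_zero]
    exact Submodule.zero_mem _
  add_mem' := fun {a b} ha hb => by
    simp only [Set.mem_setOf_eq, map_add] at ha hb ⊢
    exact Submodule.add_mem _ ha hb
  smul_mem' := fun p k hk => by
    simp only [Set.mem_setOf_eq, ιK_smul] at hk ⊢
    exact Submodule.smul_mem _ _ hk

/-- Membership in `Z_q`. [cite: OkonekSchneiderSpindler1980, Ch. I §1.1 (3)] -/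
theorem mem_Zsub {q : ℕ} {k : Sub (Fin (r + 1)) q → P ℂ r} :
    k ∈ Zsub r q ↔ ιK ℂ r _ k ∈ cycles (M := L ℂ r) (xL r) q := Iff.rfl

/-- Sanity (`p = 0`): `Z_0 = P`, i.e. `Ω^0 = 𝒪` — the case of the `𝒪(n)` files.
[cite: OkonekSchneiderSpindler1980, Ch. I §1.1 (3)] -/
theorem Zsub_zero : Zsub r 0 = ⊤ :=
  eq_top_iff.2 fun _ _ => mem_Zsub.2 (mem_cycles_zero (xL r) _)

/-- **The localized pieces of `Z_q` are the kernel on the localized pieces of the free module**: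
`((Z_q)_{x_s})_n = ((P^{Sub q})_{x_s})_n ∩ ker ∂` (localization is exact; all `x_i` are units in
`L`). [cite: SerreFAC1955, n° 64] -/
theorem mem_locDeg_Zsub_iff {q : ℕ} (n : ℤ) (s : Finset (Fin (r + 1)))
    (v : Sub (Fin (r + 1)) q → L ℂ r) :
    v ∈ locDeg (fun _ => (q : ℤ)) (Zsub r q) s n ↔
      v ∈ locDeg (fun _ => (q : ℤ)) (⊤ : Submodule (P ℂ r) (Sub (Fin (r + 1)) q → P ℂ r)) s n ∧
        v ∈ cycles (M := L ℂ r) (xL r) q := by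
  rw [mem_locDeg, mem_locDeg, mem_loc, mem_loc]
  constructor
  · rintro ⟨⟨N, k, hk, hv⟩, hdeg⟩
    refine ⟨⟨⟨N, k, trivial, hv⟩, hdeg⟩, ?_⟩
    have h1 : xs ℂ s N • v ∈ cycles (M := L ℂ r) (xL r) q := by rw [hv]; exact hk
    have h2 := Submodule.smul_mem _ (xs ℂ s (-(N : ℤ))) h1
    rwa [smul_smul, xs_neg_mul_xs, one_smul] at h2
  · rintro ⟨⟨⟨N, k, -, hv⟩, hdeg⟩, hZ⟩
    refine ⟨⟨N, k, ?_, hv⟩, hdeg⟩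
    rw [mem_Zsub, ← hv]
    exact Submodule.smul_mem _ _ hZ

/-- **`∂` preserves the algebraic sections**: `∂ (((L^{Sub (q+1)})_{x_s})_n) ⊆ ((L^{Sub q})_{x_s})_n`
(shifts `q + 1` resp. `q`: multiplying a component of degree `n - q - 1` by `x_i` gives degree
`n - q`). [cite: SerreFAC1955, n° 64] -/
theorem kd_mem_locDeg_top (n : ℤ) (q : ℕ) (s : Finset (Fin (r + 1)))
    (v : Sub (Fin (r + 1)) (q + 1) → L ℂ r)
    (hv : v ∈ locDeg (fun _ => ((q + 1 : ℕ) : ℤ)) (⊤ : Submodule (P ℂ r) _) s n) :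
    kd (xL r) q v ∈ locDeg (fun _ => (q : ℤ)) (⊤ : Submodule (P ℂ r) _) s n := by
  rw [mem_locDeg_top_iff] at hv ⊢
  intro I
  rw [kd_apply]
  refine Submodule.sum_mem _ fun i _ => ?_
  apply sign_mul_smul_mem
  rw [smul_eq_mul]
  by_cases h : (insert i I.1).card = q + 1
  · rw [extL_apply_of_eq h]
    have := xL_mul_mem_algPiece (hv ⟨insert i I.1, h⟩) i
    convert this using 2
    push_cast; ring
  · rw [extL_apply_of_ne h, mul_zero]; exact Submodule.zero_mem _

/-- **On `U_s ∋ i` the cone `x_i⁻¹ e_i ∧ ·` preserves the algebraic sections.**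
[cite: SerreFAC1955, n° 64] -/
theorem kh_mem_locDeg_top (n : ℤ) (q : ℕ) (s : Finset (Fin (r + 1))) {i : Fin (r + 1)} (hi : i ∈ s)
    (w : Sub (Fin (r + 1)) q → L ℂ r)
    (hw : w ∈ locDeg (fun _ => (q : ℤ)) (⊤ : Submodule (P ℂ r) _) s n) :
    kh (uL r i) i q w ∈ locDeg (fun _ => ((q + 1 : ℕ) : ℤ)) (⊤ : Submodule (P ℂ r) _) s n := by
  rw [mem_locDeg_top_iff] at hw ⊢
  intro K
  rw [kh_apply]
  apply sign_mul_smul_mem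
  rw [smul_eq_mul]
  by_cases h : (K.1.erase i).card = q
  · rw [extL_apply_of_eq h]
    have := uL_mul_mem_algPiece (hw ⟨K.1.erase i, h⟩) hi
    convert this using 2
    push_cast; ring
  · rw [extL_apply_of_ne h, mul_zero]; exact Submodule.zero_mem _

variable (r) in
/-- **Serre's algebraic section functor on the Koszul complex** (the ALGEBRAIC Koszul–Čech datum in
degree `n`): `Γ(U_s, Λ^q(n)) = LaurentCech.locDeg (fun _ => q) ⊤ s n` and
`Γ(U_s, Ω^q(n)) = LaurentCech.locDeg (fun _ => q) (Zsub r q) s n`, so that its Čech complexes are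
the tree's `LaurentCech.cech (fun _ => q) ⊤ n` and `LaurentCech.cech (fun _ => q) (Zsub r q) n`.
[cite: SerreFAC1955, n° 64] [cite: SerreGAGA1956, n° 13] -/
def algDatum (n : ℤ) : KoszulCech.Datum ℂ (L ℂ r) (xL r) (uL r) where
  G q s := locDeg (fun _ : Sub (Fin (r + 1)) q => (q : ℤ)) (⊤ : Submodule (P ℂ r) _) s n
  monoG _ := locDeg_mono _ _ n
  E q s := locDeg (fun _ : Sub (Fin (r + 1)) q => (q : ℤ)) (Zsub r q) s n
  monoE _ := locDeg_mono _ _ n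
  mem_E _ s v := mem_locDeg_Zsub_iff n s v
  kd_mem q s v hv := kd_mem_locDeg_top n q s v hv
  kh_mem q s _ hi w hw := kh_mem_locDeg_top n q s hi w hw

/-! ### The holomorphic sections and the holomorphic datum -/

/-- `F_m(s)` is stable under multiplication by `x_i`, landing in degree `m + 1`.
[cite: SerreGAGA1956, n° 16] -/
theorem xL_smul_mem_holFamily {m : ℤ} {s : Finset (Fin (r + 1))} {f : holTorus r}
    (hf : f ∈ GAGATwist.holFamily r m s) (i : Fin (r + 1)) :
    xL r i • f ∈ GAGATwist.holFamily r (m + 1) s := by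
  obtain ⟨g, hg, hgh, hfg⟩ := hf
  refine ⟨fun x => x i * g x, (differentiable_apply (𝕜 := ℂ) i).differentiableOn.mul hg,
    fun x hx c hc => ?_, fun x hx => ?_⟩
  · dsimp only
    rw [Pi.smul_apply, smul_eq_mul, hgh hx hc, zpow_add_one₀ hc]
    ring
  · rw [coe_smul_apply, lauEval_xL, hfg hx]

/-- On `U_s ∋ i`, `F_m(s)` is stable under multiplication by `x_i⁻¹`, landing in degree `m - 1`
(`x_i` does not vanish on the cone `Û_s`). [cite: SerreGAGA1956, n° 16] -/
theorem uL_smul_mem_holFamily {m : ℤ} {s : Finset (Fin (r + 1))} {f : holTorus r}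
    (hf : f ∈ GAGATwist.holFamily r m s) {i : Fin (r + 1)} (hi : i ∈ s) :
    uL r i • f ∈ GAGATwist.holFamily r (m - 1) s := by
  obtain ⟨g, hg, hgh, hfg⟩ := hf
  refine ⟨fun x => (x i)⁻¹ * g x, DifferentiableOn.mul ?_ hg, fun x hx c hc => ?_, fun x hx => ?_⟩
  · exact ((differentiable_apply (𝕜 := ℂ) i).differentiableOn).inv
      fun x hx => mem_coordCone.1 hx i hi
  · dsimp only
    have hxi : x i ≠ 0 := mem_coordCone.1 hx i hi
    rw [Pi.smul_apply, smul_eq_mul, hgh hx hc, mul_inv, zpow_sub_one₀ hc]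
    field_simp
  · rw [coe_smul_apply, lauEval_uL, hfg hx]

variable (r) in
/-- **The holomorphic sections `Γ(U_s^h, Ω^q(n)^h)`** in Serre's cone description: the tuples
`(f_I)_{#I = q}` of holomorphic functions on `Û_s`, `f_I` homogeneous of degree `n - q`
(`GAGAFree.holFamily r (fun _ => q) n s` = `Γ(U_s^h, Λ^q(n)^h)`), killed by the Koszul contraction
`∂` — the sections over `U_s^h` of the kernel sheaf of `Λ^q 𝒪(-1)^{r+1}(n)^h → Λ^{q-1} 𝒪(-1)^{r+1}(n)^h`,
i.e. of `Ω^q_{ℙ_r}(n)^h` [OSS (3)] (sections of a kernel sheaf are the kernel on sections).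
[cite: SerreGAGA1956, n° 16] [cite: OkonekSchneiderSpindler1980, Ch. I §1.1 (3)] -/
def holFormsFamily (q : ℕ) (n : ℤ) (s : Finset (Fin (r + 1))) :
    Submodule ℂ (Sub (Fin (r + 1)) q → holTorus r) :=
  GAGAFree.holFamily r (fun _ => (q : ℤ)) n s ⊓ (cycles (M := holTorus r) (xL r) q).restrictScalars ℂ

/-- Membership in `Γ(U_s^h, Ω^q(n)^h)`. [cite: SerreGAGA1956, n° 16] -/
theorem mem_holFormsFamily {q : ℕ} {n : ℤ} {s : Finset (Fin (r + 1))}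
    {f : Sub (Fin (r + 1)) q → holTorus r} :
    f ∈ holFormsFamily r q n s ↔
      f ∈ GAGAFree.holFamily r (fun _ => (q : ℤ)) n s ∧ f ∈ cycles (M := holTorus r) (xL r) q :=
  Iff.rfl

/-- Sanity (`q = 0`): `Γ(U_s^h, Ω^0(n)^h) = Γ(U_s^h, 𝒪(n)^h)`, the family of the `𝒪(n)` files.
[cite: SerreGAGA1956, n° 16] -/
theorem holFormsFamily_zero (n : ℤ) (s : Finset (Fin (r + 1))) :
    holFormsFamily r 0 n s = GAGAFree.holFamily r (fun _ => ((0 : ℕ) : ℤ)) n s :=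
  le_antisymm inf_le_left fun _ hf => ⟨hf, mem_cycles_zero (xL r) _⟩

/-- Restriction is inclusion. [cite: SerreGAGA1956, n° 16] -/
theorem holFormsFamily_mono (q : ℕ) (n : ℤ) : Monotone (holFormsFamily r q n) :=
  fun _ _ hst => inf_le_inf_right _ (GAGAFree.holFamily_mono _ n hst)

/-- **`∂` preserves the holomorphic sections.** [cite: SerreGAGA1956, n° 16] -/
theorem kd_mem_holFamily (n : ℤ) (q : ℕ) (s : Finset (Fin (r + 1)))
    (f : Sub (Fin (r + 1)) (q + 1) → holTorus r)
    (hf : f ∈ GAGAFree.holFamily r (fun _ => ((q + 1 : ℕ) : ℤ)) n s) :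
    kd (xL r) q f ∈ GAGAFree.holFamily r (fun _ => (q : ℤ)) n s := by
  rw [GAGAFree.mem_holFamily] at hf ⊢
  intro I
  rw [kd_apply]
  refine Submodule.sum_mem _ fun i _ => ?_
  apply sign_mul_smul_mem
  by_cases h : (insert i I.1).card = q + 1
  · rw [extL_apply_of_eq h]
    have := xL_smul_mem_holFamily (hf ⟨insert i I.1, h⟩) i
    convert this using 2
    push_cast; ring
  · rw [extL_apply_of_ne h, smul_zero]; exact Submodule.zero_mem _

/-- **On `U_s ∋ i` the cone `x_i⁻¹ e_i ∧ ·` preserves the holomorphic sections.**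
[cite: SerreGAGA1956, n° 16] -/
theorem kh_mem_holFamily (n : ℤ) (q : ℕ) (s : Finset (Fin (r + 1))) {i : Fin (r + 1)} (hi : i ∈ s)
    (f : Sub (Fin (r + 1)) q → holTorus r) (hf : f ∈ GAGAFree.holFamily r (fun _ => (q : ℤ)) n s) :
    kh (uL r i) i q f ∈ GAGAFree.holFamily r (fun _ => ((q + 1 : ℕ) : ℤ)) n s := by
  rw [GAGAFree.mem_holFamily] at hf ⊢
  intro K
  rw [kh_apply]
  apply sign_mul_smul_mem
  by_cases h : (K.1.erase i).card = q
  · rw [extL_apply_of_eq h]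
    have := uL_smul_mem_holFamily (hf ⟨K.1.erase i, h⟩) hi
    convert this using 2
    push_cast; ring
  · rw [extL_apply_of_ne h, smul_zero]; exact Submodule.zero_mem _

variable (r) in
/-- **Serre's holomorphic section functor on the Koszul complex** (the HOLOMORPHIC Koszul–Čech datum
in degree `n`): `Γ(U_s^h, Λ^q(n)^h) = GAGAFree.holFamily r (fun _ => q) n s` and
`Γ(U_s^h, Ω^q(n)^h) = holFormsFamily r q n s`. [cite: SerreGAGA1956, n° 16] [cite: SerreGAGA1956, n° 13] -/
def holDatum (n : ℤ) : KoszulCech.Datum ℂ (holTorus r) (xL r) (uL r) where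
  G q s := GAGAFree.holFamily r (fun _ : Sub (Fin (r + 1)) q => (q : ℤ)) n s
  monoG _ := GAGAFree.holFamily_mono _ n
  E q s := holFormsFamily r q n s
  monoE q := holFormsFamily_mono q n
  mem_E _ _ _ := mem_holFormsFamily
  kd_mem q s v hv := kd_mem_holFamily n q s v hv
  kh_mem q s _ hi w hw := kh_mem_holFamily n q s hi w hw

variable (r) in
/-- **The holomorphic ordered Čech complex `Č•(𝔘^h; Ω^q(n)^h)` of `ℙ_r(ℂ)`** for the standard cover.
[cite: SerreGAGA1956, n° 13] -/
def holCech (q : ℕ) (n : ℤ) : CochainComplex (ModuleCat.{0} ℂ) ℤ :=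
  OrderedCech.complex (holFormsFamily r q n) (holFormsFamily_mono q n)

/-! ### Evaluation as a morphism of data; the comparison maps -/

variable (r) in
/-- **Evaluation of algebraic sections as holomorphic ones** is a morphism of Koszul–Čech data
(`GAGAFree.ψ_mem_algFamily` with `GAGAFree.algFamily_le_holFamily`). [cite: SerreGAGA1956, n° 13 Lemme 5] -/
def algHolHom (n : ℤ) : (algDatum r n).Hom (holDatum r n) where
  ψ := holEvalL r
  mapsTo q s _ hv :=
    GAGAFree.algFamily_le_holFamily _ n s (GAGAFree.ψ_mem_algFamily (fun _ => (q : ℤ)) n hv)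

/-- Changing the linear map of `complexMap` along an equality. [cite: GortzWedhorn2023, (21.14)–(21.15)] -/
private theorem complexMap_congr {𝕂 𝕂' : Type} [AddCommGroup 𝕂] [Module ℂ 𝕂] [AddCommGroup 𝕂']
    [Module ℂ 𝕂'] {F : Finset (Fin (r + 1)) → Submodule ℂ 𝕂} {G : Finset (Fin (r + 1)) → Submodule ℂ 𝕂'}
    {ψ₁ ψ₂ : 𝕂 →ₗ[ℂ] 𝕂'} (h : ψ₁ = ψ₂) (h₁ : ∀ s, ∀ v ∈ F s, ψ₁ v ∈ G s)
    (h₂ : ∀ s, ∀ v ∈ F s, ψ₂ v ∈ G s) (hF : Monotone F) (hG : Monotone G) :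
    complexMap ψ₁ h₁ hF hG = complexMap ψ₂ h₂ hF hG := by
  subst h; rfl

/-- **The free comparison maps of the evaluation morphism are the tree's GAGA maps for the free
sheaves** `GAGAFree.cechComparison r (fun _ => q) n`. [cite: SerreGAGA1956, n° 13 Lemme 5] -/
theorem freeMap_eq (n : ℤ) (q : ℕ) :
    (algHolHom r n).freeMap q = GAGAFree.cechComparison r (fun _ : Sub (Fin (r + 1)) q => (q : ℤ)) n :=
  complexMap_congr (LinearMap.ext fun _ => rfl) _ _ _ _

/-- The free comparison maps are quasi-isomorphisms (Lemme 5, `GAGAFree.quasiIso_cechComparison`).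
[cite: SerreGAGA1956, n° 13 Lemme 5] -/
theorem quasiIso_freeMap (n : ℤ) (q : ℕ) : QuasiIso ((algHolHom r n).freeMap q) := by
  rw [freeMap_eq]
  exact GAGAFree.quasiIso_cechComparison _ n

variable (r) in
/-- **The GAGA comparison map for `Ω^p_{ℙ_r}(n)`**: evaluation of the algebraic Čech cochains of the
graded kernel module `Z_p` (`LaurentCech.cech (fun _ => p) (Zsub r p) n`) as holomorphic Čech cochains
of `Ω^p(n)^h`. [cite: SerreGAGA1956, n° 12 Théorème 1] -/
def cechComparison (p : ℕ) (n : ℤ) :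
    LaurentCech.cech (fun _ : Sub (Fin (r + 1)) p => (p : ℤ)) (Zsub r p) n ⟶ holCech r p n :=
  (algHolHom r n).kerMap p

/-- **Serre's GAGA Théorème 1 for the sheaves of twisted differential forms `Ω^p_{ℙ_r}(n)` on
`ℙ_r(ℂ)`**, all `r, p ≥ 0`, `n ∈ ℤ`: the comparison map from the algebraic Čech complex of `Ω^p(n)`
(the graded kernel module `Z_p`, by the exterior powers of the Euler sequence) to the holomorphic
ordered Čech complex of `Ω^p(n)^h` on the standard cover is a quasi-isomorphism — by Serre's
dévissage from Lemme 5 (`KoszulCech.Datum.Hom.quasiIso_kerMap`).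
[cite: SerreGAGA1956, n° 12 Théorème 1 and n° 13] [cite: OkonekSchneiderSpindler1980, Ch. I §1.1 (3)] -/
theorem quasiIso_cechComparison (p : ℕ) (n : ℤ) : QuasiIso (cechComparison r p n) :=
  (algHolHom r n).quasiIso_kerMap uL_mul_xL (quasiIso_freeMap n) p

/-- **The GAGA isomorphisms `Ȟ^a(𝔘, Ω^p(n)) ≅ Ȟ^a(𝔘^h, Ω^p(n)^h)` on `ℙ_r(ℂ)`**, all Čech degrees.
[cite: SerreGAGA1956, n° 12 Théorème 1] -/
theorem isIso_homologyMap_cechComparison (p : ℕ) (n a : ℤ) :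
    IsIso (HomologicalComplex.homologyMap (cechComparison r p n) a) := by
  haveI := quasiIso_cechComparison (r := r) p n
  infer_instance

end GAGAForms

end Literature.AlgebraicGeometry.HodgeTheory
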